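import Summits.ResolutionOfSingularities.ResolutionOfSingularities.Theorems.Globalisation.Negative.StubCaSheafLocalCusp
import Summits.ResolutionOfSingularities.ResolutionOfSingularities.Theorems.Globalisation.Negative.StubCaSheafExt
import Mathlib.Algebra.Polynomial.Roots
import Mathlib.FieldTheory.IsAlgClosed.AlgebraicClosure
import Mathlib.Algebra.Field.ZMod
import Mathlib.Tactic.LinearCombination
import Mathlib.Tactic.Push
import HarnessLib

/-!
# The cohomology annihilator does NOT localise: `stub_caSheaf` of the birth line of crux
# `Globalisation` (stmt-ResolutionOfSingularities-16486, route `HomologicalConductor`) is false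
# — negative lemma (cdisprove seat), supports the crux item

The crux `HomologicalConductor.Globalisation` ("valuative termination of the canonical ca-tower
⇒ `ResolutionInChar p`") is implied by the summit, hence irrefutable short of a counterexample to
resolution; its stated MECHANISM is "the Iyengar–Takahashi cohomology annihilator `ca` is a
quasi-coherent ideal sheaf", typed in the crux's birth skeleton
`Cruxes/Globalisation/Lines/birth_HomologicalConductor.lean` as the stub
`CaSheaf p : ∀ k R (f.g. domain over a field k of char p) U R' (IsLocalization U R'),
(ca R).map (algebraMap R R') = ca R'` and consumed by `stub_atlas` / `stub_globalTower`.

**Theorem (`caSheaf_false`, `stub_caSheaf_false`; sorry-free, axioms `propext`,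
`Classical.choice`, `Quot.sound`).** For every prime `p`, `CaSheaf p` is false; hence
`Sig.stub_caSheaf = ∀ p, p.Prime → CaSheaf p` is false. (The statements refuted here are the
verbatim unfoldings of those two `def`s; `example : ¬ Sig.stub_caSheaf := stub_caSheaf_false`
type-checks against the Lines file.)

**Witness.** `k = 𝔽̄_p` (any infinite field of characteristic `p`), `R = k[x,y,z]/(y² - x³)`
(the cusp × 𝔸¹, realised as `k[z][x][y] ⧸ ker θ`, `θ : x ↦ t², y ↦ t³` into `k[z][t]`, with
`ker θ = (y² - x³)` PROVED, so `R ≅ k[t²,t³,z]` is a finitely generated domain),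
`U = {s : s(t = 0) ≠ 0} = R ∖ (x, y)` (the complement of the generic point `𝔮` of the singular
line), `R' = U⁻¹R = R_𝔮` = the cusp over `k(z)`.
* `x/1 ∈ ca²(R_𝔮) ⊆ ca(R_𝔮)` (`CuspCylinder.x_mem_cohomologyAnnihilator`): `x = t²` is a CONDUCTOR
  element of `T = R_𝔮` into the PID `T̄ = (ι₀U)⁻¹k(z)[t] ⊇ k(z)[t]_(t)` (`conductor_x`:
  `t²·T̄ ⊆ T`), and a conductor element into a PID kills `Ext²_T(mod T, mod T)`
  (`Conductor.mem_cohomologyAnnihilatorOfDegree_two_of_conductor`: dimension shifting to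
  `Ext¹(ΩM, N)`, `ΩM ≤ Tⁿ`; `T̄·ΩM` is `T̄`-free, a `T̄`-linear section of `T̄ᵐ ↠ T̄·ΩM` times the
  conductor gives a factorisation of `x • 𝟙_{ΩM}` through the free module `Tᵐ`, on which `Ext¹`
  vanishes) — this reproves "conductor ⊆ ca" (Esentepe) classification-free.
* `s·x ∉ ca(R)` for every `s ∈ U` (`CuspCylinder.mul_x_notMem_cohomologyAnnihilator`): pick
  `c ∈ k` with `s(0,0,c) ≠ 0` (`k` infinite) and the matrix factorisation
  `φ_c = [[y + x(z-c), x²], [x - (z-c)², y - x(z-c)]]`, `ψ_c = adj φ_c`, `φ_c ψ_c = ψ_c φ_c = (y²-x³)I`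
  of `y² - x³`; `M_c = coker φ_c` has the 2-periodic resolution by `φ_c, ψ_c` (exactness
  `ker φ = range ψ`, `ker ψ = range φ` PROVED by cancelling `f` in the domain `k[z][x][y]`), so
  `s x ∈ caⁿ(R)` descends (injective connecting maps along the two syzygy sequences, transported
  along `M_c ≅ ΩM'_c`, `M'_c ≅ ΩM_c`) to `(s x) · [0 → ΩM_c → R² → M_c → 0] = 0` in
  `Ext¹(M_c, ΩM_c)`; the covariant long exact sequence then lifts `(s x)•𝟙_{M_c}` through
  `R² ↠ M_c`, which unwinds to the scalar identity
  `s x + (y + xg)κ₀ + (x - g²)κ₁ = (y - xg)l₀ - x²l₁` in `R` (`g = z - c`); lifted to `k[z][x][y]`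
  modulo `(y² - x³)` and evaluated at `y = 0`, divided by `x`, evaluated at `x = 0` and at `z = c`
  it gives `s(0,0,c) = 0` (`endgame`) — contradiction.
* Hence `x/1 ∈ ca(R_𝔮) ∖ (ca R)·R_𝔮` (`map_cohomologyAnnihilator_ne`), i.e. `¬ CaSheaf p`.

**Consequences for the crux (informational; this lemma changes no verdict).** The birth line
`Lines/birth_HomologicalConductor.lean` is dead AS TYPED: `stub_caSheaf` can never be proved, so
`Globalisation_proof` cannot be completed through it, and the `CaSheaf p`-hypotheses of
`stub_atlas` / `stub_globalTower` are vacuous. The failure sits at a NON-MAXIMAL prime (the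
generic point of a positive-dimensional singular stratum); the paper analysis on file
(`Cruxes/Globalisation/CRUX-ATTACK-HomologicalConductor-r1.md`, Findings 2–4) indicates that
`ca` does localise at maximal ideals of this `R` and at isolated singularities, and that on this
witness both ideals `ca(R)R_𝔮 = (x², y)` and `ca(R_𝔮) = (x, y)` have the SAME normalised blow-up (the
normalisation), so the weaker statement the line actually consumes — "same normalised blow-up"
(CaSheafNBl) — is untouched by this witness and is the natural re-cut of stub 1.

Anti-leakage: everything here concerns the load-bearing mechanism (`ca` is a sheaf) of THIS crux;
the general lemma `Conductor.mem_cohomologyAnnihilatorOfDegree_two_of_conductor` is the one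
reusable piece (conductor into a PID ⊆ `ca²`).
-/

set_option linter.dupNamespace false

-- nested polynomial rings (`k[z][x][y]`) need nested instance synthesis during unification
set_option maxSynthPendingDepth 3

noncomputable section

namespace Summit.ResolutionOfSingularities.ResolutionOfSingularities.Theorems.Globalisation.Negative

open Polynomial Literature.RingTheory.CohomologyAnnihilator

namespace CuspCylinder

open CategoryTheory CategoryTheory.Abelian Literature.RingTheory.CohomologyAnnihilator Polynomial

variable (k : Type) [Field k] (c : k)

/-- The polynomial endgame: the identity of `relation_of_lift`, lifted to `P = k[z][x][y]` with
`r = s · x`, forces `s(x=0, y=0, z=c) = 0` — evaluate `y ↦ 0`, divide by `x`, evaluate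
`x ↦ 0`, evaluate `z ↦ c`. -/
theorem endgame (ŝ K₀ K₁ L₀ L₁ E' : P k)
    (hD : ŝ * xP k + (yP k + xP k * gP k c) * K₀ + (xP k - gP k c ^ 2) * K₁ -
        ((yP k - xP k * gP k c) * L₀ - xP k ^ 2 * L₁) = f k * E') :
    ((ŝ.eval 0).eval 0).eval c = 0 := by
  have h1 := congrArg (Polynomial.eval (0 : B k)) hD
  simp only [xP, yP, gP, f, eval_mul, eval_add, eval_sub, eval_pow, eval_C, eval_X] at h1
  -- evaluate at `x = 0`
  have h2 := congrArg (Polynomial.eval (0 : Polynomial k)) h1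
  simp only [eval_mul, eval_add, eval_sub, eval_pow, eval_C, eval_X, eval_zero] at h2
  have hk₁ : (K₁.eval 0).eval 0 = 0 := by
    have hG : ((X - C c : Polynomial k) ^ 2) ≠ 0 := pow_ne_zero _ (X_sub_C_ne_zero c)
    refine (mul_eq_zero.mp ?_).resolve_left hG
    linear_combination -h2
  obtain ⟨m, hm⟩ : (X : B k) ∣ K₁.eval 0 := X_dvd_iff.mpr (by rwa [coeff_zero_eq_eval_zero])
  rw [hm] at h1
  have h3 : (X : B k) * (ŝ.eval 0 + C (X - C c) * K₀.eval 0 + (X - C (X - C c) ^ 2) * m +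
      C (X - C c) * L₀.eval 0 + X * L₁.eval 0 + X ^ 2 * E'.eval 0) = 0 := by
    linear_combination h1
  have h4 := (mul_eq_zero.mp h3).resolve_left X_ne_zero
  have h5 := congrArg (Polynomial.eval (0 : Polynomial k)) h4
  simp only [eval_mul, eval_add, eval_sub, eval_pow, eval_C, eval_X, eval_zero] at h5
  have h6 := congrArg (Polynomial.eval c) h5
  simp only [eval_mul, eval_add, eval_sub, eval_pow, eval_C, eval_X, eval_zero] at h6
  linear_combination h6

/-- A non-zero polynomial over an infinite field has a non-root. -/
theorem exists_eval_ne_zero [Infinite k] {q : Polynomial k} (hq : q ≠ 0) : ∃ c : k, q.eval c ≠ 0 := by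
  by_contra h
  push Not at h
  exact hq (Polynomial.zero_of_eval_zero q h)

/-- **The obstruction.** Over an infinite field `k`: for `s ∈ U` (i.e. `s ∉ (x, y)`),
`s · x ∉ ca(R)`. -/
theorem mul_x_notMem_cohomologyAnnihilator [Infinite k] {s : R k} (hs : s ∈ U k) :
    s * x k ∉ cohomologyAnnihilator (R k) := by
  intro hmem
  obtain ⟨ŝ, rfl⟩ := Ideal.Quotient.mk_surjective s
  have hs0 : (ŝ.eval 0).eval 0 ≠ 0 := by
    rw [mem_U_iff, ι_mk, coeff_zero_θ, coeff_zero_eq_eval_zero, coeff_zero_eq_eval_zero] at hs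
    exact hs
  obtain ⟨c, hc⟩ := exists_eval_ne_zero k hs0
  have h0 := smul_extClass_eq_zero k c hmem
  obtain ⟨σ, hσ⟩ := exists_lift_of_smul_extClass_eq_zero k c h0
  obtain ⟨κ₀, κ₁, l₀, l₁, hrel⟩ := relation_of_lift k c σ hσ
  obtain ⟨K₀, rfl⟩ := Ideal.Quotient.mk_surjective κ₀
  obtain ⟨K₁, rfl⟩ := Ideal.Quotient.mk_surjective κ₁
  obtain ⟨L₀, rfl⟩ := Ideal.Quotient.mk_surjective l₀
  obtain ⟨L₁, rfl⟩ := Ideal.Quotient.mk_surjective l₁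
  have hD : Ideal.Quotient.mk (RingHom.ker (θ k))
      (ŝ * xP k + (yP k + xP k * gP k c) * K₀ + (xP k - gP k c ^ 2) * K₁ -
        ((yP k - xP k * gP k c) * L₀ - xP k ^ 2 * L₁)) = 0 := by
    simp only [map_sub, map_add, map_mul, map_pow, mk_xP, mk_yP, mk_gP]
    rw [sub_eq_zero]
    exact hrel
  rw [mk_eq_zero_iff] at hD
  obtain ⟨E', hE'⟩ := hD
  exact hc (endgame k c ŝ K₀ K₁ L₀ L₁ E' hE')

end CuspCylinder

/-! ## Assembly: the cohomology annihilator does not localise -/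

namespace CuspCylinder

open Literature.RingTheory.CohomologyAnnihilator

variable (k : Type) [Field k]

/-- `U` consists of non-zero-divisors of the domain `R`. -/
theorem U_le_nonZeroDivisors : U k ≤ nonZeroDivisors (R k) := by
  intro s hs
  apply mem_nonZeroDivisors_of_ne_zero
  rintro rfl
  exact zero_notMem_U k hs

/-- Over an infinite field, `ca(R)·R_𝔮 ≠ ca(R_𝔮)` for the cusp-cylinder `R` at the generic point
`𝔮 = (x, y)` of its singular line: `x/1` lies in the right-hand side and not in the left. -/
theorem map_cohomologyAnnihilator_ne [Infinite k] :
    (cohomologyAnnihilator (R k)).map (algebraMap (R k) (T k)) ≠ cohomologyAnnihilator (T k) := by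
  intro h
  have hx : algebraMap (R k) (T k) (x k) ∈ (cohomologyAnnihilator (R k)).map (algebraMap _ _) := by
    rw [h]
    exact x_mem_cohomologyAnnihilator k
  rw [IsLocalization.mem_map_algebraMap_iff (U k)] at hx
  obtain ⟨⟨⟨a, ha⟩, ⟨s, hs⟩⟩, h'⟩ := hx
  have h'' : x k * s = a := by
    apply IsLocalization.injective (T k) (U_le_nonZeroDivisors k)
    rw [map_mul]
    exact h'
  have hmem : s * x k ∈ cohomologyAnnihilator (R k) := by
    rw [mul_comm, h'']
    exact ha
  exact mul_x_notMem_cohomologyAnnihilator k hs hmem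

end CuspCylinder

open Literature.RingTheory.CohomologyAnnihilator in
/-- **`CaSheaf p` is false for every prime `p`** (the statement inside `¬` is, verbatim, the body
of `CaSheaf p` in `Cruxes/Globalisation/Lines/birth_HomologicalConductor.lean`). Witness:
`k = 𝔽̄_p`, `R = k[x,y,z]/(y² - x³)`, `U = R ∖ (x, y)`, `R' = U⁻¹R`. -/
theorem caSheaf_false (p : ℕ) (hp : p.Prime) :
    ¬ (∀ (k R : Type) [Field k] [CharP k p] [CommRing R] [IsDomain R] [Algebra k R],
        Algebra.FiniteType k R →
          ∀ (U : Submonoid R) (R' : Type) [CommRing R'] [Algebra R R'], IsLocalization U R' →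
            (cohomologyAnnihilator R).map (algebraMap R R') = cohomologyAnnihilator R') := by
  intro H
  haveI : Fact p.Prime := ⟨hp⟩
  let k : Type := AlgebraicClosure (ZMod p)
  exact CuspCylinder.map_cohomologyAnnihilator_ne k
    (H k (CuspCylinder.R k) inferInstance (CuspCylinder.U k) (CuspCylinder.T k) inferInstance)

open Literature.RingTheory.CohomologyAnnihilator in
/-- **`Sig.stub_caSheaf` is false** (the statement inside `¬` is, verbatim, `∀ p, p.Prime → CaSheaf p`
unfolded). -/
theorem stub_caSheaf_false :
    ¬ (∀ p : ℕ, p.Prime → ∀ (k R : Type) [Field k] [CharP k p] [CommRing R] [IsDomain R] [Algebra k R],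
        Algebra.FiniteType k R →
          ∀ (U : Submonoid R) (R' : Type) [CommRing R'] [Algebra R R'], IsLocalization U R' →
            (cohomologyAnnihilator R).map (algebraMap R R') = cohomologyAnnihilator R') :=
  fun H => caSheaf_false 2 Nat.prime_two (H 2 Nat.prime_two)

end Summit.ResolutionOfSingularities.ResolutionOfSingularities.Theorems.Globalisation.Negative

end
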